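import Mathlib.Algebra.Group.Commutator
import Mathlib.NumberTheory.Padics.PadicVal.Basic
import Mathlib.NumberTheory.Padics.RingHoms
import Mathlib.Algebra.BigOperators.Group.Finset.Basic
import Mathlib.Algebra.Group.Submonoid.Basic
import Mathlib.Tactic.Linarith
import HarnessLib

/-!
# [IUTchIII] Remarks 1.5.1 (ii) and 2.3.3 (vi)–(viii): the elementary group- and number-theoretic facts quoted

Mochizuki, *Inter-universal Teichmüller Theory III*, kurims manuscript (May 2020)
[cite: Mochizuki2012, III Rmk 1.5.1 (ii) p.52; Rmk 2.3.3 (vi)–(viii) pp.80–83] (D-0012 claim key, status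
disputed; the facts typed here are classical and this file takes no side).

Printed text.
* Rmk 1.5.1 (ii) p.52: replacing a diagonal embedding `G ↪ G × G` by its `(G × G)`-conjugacy class
  "implies that one must consider identifications `(g, g) ∼ (g, hgh⁻¹) = (g, [h, g]·g)` [where `g, h ∈ G`]
  — i.e., one must identify `(g, g)` with the product of `(g, g)` with `(1, [h, g])`."
* Rmk 2.3.3 (vi) p.80–81: the cyclotome `μ^∀_{et}` is "subject to indeterminacies with respect to
  multiplication by elements of the submonoid `I^{ord} ⊆ ±ℕ_{≥1} := ℕ_{≥1} × {±1}` generated by the orders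
  [`∈ ℤ`] of the zeroes/poles of the rational function(s)"; in the theta case "`I^{ord} = {1}` —
  precisely as a consequence of the fact … that the order [`∈ ℤ`] of the zeroes/poles of the theta
  function at every cusp is equal to `1`" [Fig. 2.5: `+1 +1 +1 …`] — "a state of affairs that can never
  occur in the case of an algebraic rational function [i.e., since the sum of the orders [`∈ ℤ`] of the
  zeroes/poles of an algebraic rational function is always equal to `0`]!" [Fig. 2.6:
  `0 0 +8 −5 −6 +3 0 0`]; in the number field case the indeterminacy by `I^{ord}_{≥1}` "is avoided precisely
  … by applying the property `ℚ_{>0} ∩ Ẑ^× = {1}`".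
* Rmk 2.3.3 (vii) p.82: that property is "fundamentally incompatible with the topology of the profinite
  groups involved [as can be seen, for instance, by considering the fact that `ℕ_{≥1}` forms a dense subset
  of `Ẑ`]."

Typed and PROVED: `conj_eq_commutatorElement_mul` / `prod_conj_eq` (Rmk 1.5.1 (ii), in any group);
`ordersMonoid` (= `I^{ord}` as a submonoid of the multiplicative monoid `ℤ`, which contains
`±ℕ_{≥1} = ℤ ∖ {0}`), `ordersMonoid_theta` (all orders `1` ⇒ `I^{ord} = {1}`),
`sum_ne_zero_of_forall_eq_one` (orders all `1` on a nonempty set of cusps have nonzero sum — so by the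
degree-zero property this "can never occur" for a rational function; the degree-zero property itself,
`deg (div f) = 0` on a proper curve, is NOT proved here and enters only in this docstring),
`eq_one_of_padicVal_eq` / `Rat.eq_one_of_forall_padicValRat_eq_zero` (`ℚ_{>0} ∩ Ẑ^× = {1}`: a positive
rational which is a unit at every prime is `1`), and the density of `ℕ_{≥1}` in `ℤ_p` for each `p`
(`denseRange_succ_natCast_padicInt`, from Mathlib's `PadicInt.denseRange_natCast`; `Ẑ = ∏_p ℤ_p` itself is
not in Mathlib and is not built here).
-/

namespace Literature.IUT.LogThetaLattice

open scoped commutatorElement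

/-! ### Rmk 1.5.1 (ii): conjugates of the diagonal -/

/-- `hgh⁻¹ = [h, g]·g` in any group (`[h, g] = hgh⁻¹g⁻¹`). [cite: Mochizuki2012, III Rmk 1.5.1 (ii) p.52] -/
theorem conj_eq_commutatorElement_mul {G : Type*} [Group G] (g h : G) : h * g * h⁻¹ = ⁅h, g⁆ * g := by
  rw [commutatorElement_def]; group

/-- **Rmk 1.5.1 (ii)**: "`(g, hgh⁻¹) = (g, [h, g]·g)` … i.e., one must identify `(g, g)` with the product of
`(g, g)` with `(1, [h, g])`": in `G × G`, `(1, [h,g]) · (g, g) = (g, hgh⁻¹)`, the `(1, h)`-conjugate of the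
diagonal element `(g, g)`. [cite: Mochizuki2012, III Rmk 1.5.1 (ii) p.52] -/
theorem prod_conj_diag_eq {G : Type*} [Group G] (g h : G) :
    ((1 : G), h) * (g, g) * ((1 : G), h)⁻¹ = (g, h * g * h⁻¹) ∧
      ((1 : G), ⁅h, g⁆) * (g, g) = (g, h * g * h⁻¹) := by
  refine ⟨?_, ?_⟩
  · ext <;> simp
  · ext
    · simp
    · simp only [Prod.mk_mul_mk]; rw [conj_eq_commutatorElement_mul]

/-- The factor `(1, [h, g])` is trivial exactly when `h` and `g` commute — "this incompatibility may be
thought of as an essential consequence of the highly nonabelian nature of `G`".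
[cite: Mochizuki2012, III Rmk 1.5.1 (ii) p.52] -/
theorem commutatorElement_eq_one_iff_commute {G : Type*} [Group G] (g h : G) : ⁅h, g⁆ = 1 ↔ Commute h g := by
  rw [commutatorElement_eq_one_iff_mul_comm]; exact Iff.rfl

/-! ### Rmk 2.3.3 (vi): the indeterminacy monoid `I^{ord}` generated by orders of zeroes/poles -/

/-- **`I^{ord}`**: "the submonoid [of `±ℕ_{≥1} = ℕ_{≥1} × {±1}`, here: of the multiplicative monoid `ℤ`]
generated by the orders [`∈ ℤ`] of the zeroes/poles" `ord i` of the function(s) at the cusps `i`.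
[cite: Mochizuki2012, III Rmk 2.3.3 (vi) p.80] -/
def ordersMonoid {ι : Type*} (ord : ι → ℤ) : Submonoid ℤ := Submonoid.closure (Set.range ord)

/-- `I^{ord}` is trivial iff every order that occurs equals `1`. [cite: Mochizuki2012, III Rmk 2.3.3 (vi) p.81] -/
theorem ordersMonoid_eq_bot_iff {ι : Type*} (ord : ι → ℤ) : ordersMonoid ord = ⊥ ↔ ∀ i, ord i = 1 := by
  rw [ordersMonoid, ← le_bot_iff, Submonoid.closure_le]
  constructor
  · intro h i; exact (Submonoid.mem_bot.mp (h ⟨i, rfl⟩))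
  · rintro h _ ⟨i, rfl⟩; exact Submonoid.mem_bot.mpr (h i)

/-- **Theta case** [Fig. 2.5]: "the order [`∈ ℤ`] of the zeroes/poles of the theta function at every cusp is
equal to `1`" ⇒ "`(±ℕ_{≥1} ⊇) I^{ord} = {1}`". [cite: Mochizuki2012, III Rmk 2.3.3 (vi) p.81] -/
theorem ordersMonoid_theta {ι : Type*} (ord : ι → ℤ) (h : ∀ i, ord i = 1) : ordersMonoid ord = ⊥ :=
  (ordersMonoid_eq_bot_iff ord).mpr h

/-- **Why the theta configuration "can never occur" for an algebraic rational function** [Fig. 2.5 vs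
Fig. 2.6]: if every order is `1` on a nonempty finite set of cusps, the sum of the orders is positive,
whereas "the sum of the orders of the zeroes/poles of an algebraic rational function is always equal to
`0`" (degree of a principal divisor; that fact is quoted, not proved, here).
[cite: Mochizuki2012, III Rmk 2.3.3 (vi) p.81] -/
theorem sum_ne_zero_of_forall_eq_one {ι : Type*} (s : Finset ι) (hs : s.Nonempty) (ord : ι → ℤ)
    (h : ∀ i ∈ s, ord i = 1) : ∑ i ∈ s, ord i ≠ 0 := by
  rw [Finset.sum_congr rfl h, Finset.sum_const, nsmul_eq_mul, mul_one]
  exact_mod_cast (Finset.card_pos.mpr hs).ne'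

/-- The example of Fig. 2.6 (`0 0 +8 −5 −6 +3 0 0`): these orders DO sum to `0`, and `I^{ord} ≠ {1}`.
[cite: Mochizuki2012, III Rmk 2.3.3 (vi) p.82] -/
theorem fig_2_6_example :
    (0 : ℤ) + 0 + 8 + (-5) + (-6) + 3 + 0 + 0 = 0 ∧ ordersMonoid ![(0 : ℤ), 0, 8, -5, -6, 3, 0, 0] ≠ ⊥ := by
  refine ⟨by norm_num, fun h => ?_⟩
  have := (ordersMonoid_eq_bot_iff _).mp h 2
  simp at this

/-! ### Rmk 2.3.3 (vi)–(vii): `ℚ_{>0} ∩ Ẑ^× = {1}` and the density of `ℕ_{≥1}` -/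

/-- Core of **`ℚ_{>0} ∩ Ẑ^× = {1}`**: if `a, b ≥ 1` are coprime and `v_p(a) = v_p(b)` for every prime `p`
(i.e. `a/b` is a `p`-adic unit for all `p`), then `a = 1` and `b = 1`.
[cite: Mochizuki2012, III Rmk 2.3.3 (vi) p.81] -/
theorem eq_one_of_padicVal_eq {a b : ℕ} (ha : a ≠ 0) (hb : b ≠ 0) (hab : Nat.Coprime a b)
    (h : ∀ p : ℕ, p.Prime → padicValNat p a = padicValNat p b) : a = 1 ∧ b = 1 := by
  have key : ∀ {a b : ℕ}, a ≠ 0 → b ≠ 0 → Nat.Coprime a b →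
      (∀ p : ℕ, p.Prime → padicValNat p a = padicValNat p b) → a = 1 := by
    intro a b ha hb hab h
    refine Nat.eq_one_iff_not_exists_prime_dvd.mpr fun p hp hpa => ?_
    haveI := Fact.mk hp
    have hpb : ¬ p ∣ b := fun hpb => hp.ne_one ((Nat.coprime_iff_gcd_eq_one.mp hab) ▸
      Nat.dvd_gcd hpa hpb |> Nat.dvd_one.mp)
    have h1 : padicValNat p a ≠ 0 := (dvd_iff_padicValNat_ne_zero ha).mp hpa
    have h2 : padicValNat p b = 0 := padicValNat.eq_zero_of_not_dvd hpb
    exact h1 ((h p hp).trans h2)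
  exact ⟨key ha hb hab h, key hb ha hab.symm fun p hp => (h p hp).symm⟩

/-- **`ℚ_{>0} ∩ Ẑ^× = {1}`** [cite: Mochizuki2012, III Rmk 2.3.3 (vi) p.81]: a positive rational number `q`
with `v_p(q) = 0` for every prime `p` — i.e. lying in `Ẑ^× = ∏_p ℤ_p^×` under the diagonal embedding —
equals `1`. -/
theorem Rat.eq_one_of_forall_padicValRat_eq_zero (q : ℚ) (hq : 0 < q)
    (h : ∀ p : ℕ, p.Prime → padicValRat p q = 0) : q = 1 := by
  have hnum : 0 < q.num := Rat.num_pos.mpr hq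
  have hden : q.den ≠ 0 := q.den_nz
  obtain ⟨n, hn⟩ : ∃ n : ℕ, q.num = n := Int.eq_ofNat_of_zero_le hnum.le
  have hn0 : n ≠ 0 := by rintro rfl; simp [hn] at hnum
  have hcop : Nat.Coprime n q.den := by
    have := q.reduced; rwa [hn, Int.natAbs_natCast] at this
  have hval : ∀ p : ℕ, p.Prime → padicValNat p n = padicValNat p q.den := by
    intro p hp
    have := h p hp
    rw [padicValRat_def, hn, padicValInt.of_nat, sub_eq_zero] at this
    exact_mod_cast this
  obtain ⟨h1, h2⟩ := eq_one_of_padicVal_eq hn0 hden hcop hval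
  rw [← Rat.num_div_den q, hn, h1, h2]; simp

/-- Rmk 2.3.3 (vii): "`ℕ_{≥1}` forms a dense subset of `Ẑ`" — at each prime `p`, the positive integers are
dense in `ℤ_p` (Mathlib: `ℕ` is dense in `ℤ_p`; and `ℕ_{≥1}` has the same closure since `0 = lim pⁿ`).
Stated here as density of `n ↦ n + 1`. [cite: Mochizuki2012, III Rmk 2.3.3 (vii) p.82] -/
theorem denseRange_succ_natCast_padicInt (p : ℕ) [Fact p.Prime] :
    DenseRange (fun n : ℕ => ((n + 1 : ℕ) : ℤ_[p])) := by
  -- `x - 1` is a limit of naturals `n_k` (Mathlib), and `y ↦ y + 1` is continuous, so `x` is a limit of `n_k + 1`.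
  have hd : DenseRange (Nat.cast : ℕ → ℤ_[p]) := PadicInt.denseRange_natCast
  have hcont : Continuous fun y : ℤ_[p] => y + 1 := by fun_prop
  have hg : DenseRange (fun y : ℤ_[p] => y + 1) := (Homeomorph.addRight (1 : ℤ_[p])).surjective.denseRange
  have himage : DenseRange ((fun y : ℤ_[p] => y + 1) ∘ (Nat.cast : ℕ → ℤ_[p])) := hg.comp hd hcont
  convert himage using 1
  funext n
  simp

end Literature.IUT.LogThetaLattice
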